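import Summits.HodgeConjecture.HodgeConjecture.Theses.PadicSemiregularLift
import Literature.AlgebraicGeometry.HodgeTheory.SemiregularityObstructionBridge
import Literature.AlgebraicGeometry.Deformation.VectorBundleExtensionObstruction
import Literature.AlgebraicGeometry.Motives.HodgeSheaves
import Literature.AlgebraicGeometry.Motives.SupersingularAbelianVariety

/-!
# Line `fourier-rotation` for crux `PadicPridhamSemiregularity` (stmt-HodgeConjecture-13815) —
# ORACLE MODULE, **not** a concluding skeleton (crux-plan verdict: `no-skeleton`)

Route `PadicSemiregularLift`; crux P1b (informal item, NO Lean declaration in the route file —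
`Summit.HodgeConjecture.HodgeConjecture.Theses.PadicSemiregularLift.PadicPridhamSemiregularity`
does not exist, so no file can contain a theorem `PadicPridhamSemiregularity_of` concluding it BY NAME).
Independently of that mechanical fact, the Fourier–Mukai lever of card `Ideas/fourier-rotation.md`
(triage r1-1/2/3: pass, "scope-limited: abelian threefold models; g ≥ 4 is a reduction") is a
TRANSPORT argument, and the line card (`Lines/fourier-rotation.md` §4) proves a TRANSPORT NO-GO: at the
route's anchors (generic lifts, Mumford–Tate-irreducible transcendental cohomology) no kernel that is
algebraic on the generic fibre, and no level-`n` line bundle for `n ≥ 2`, separates `⊕_{q ≥ 1} H^{q,q+2}(X₁)`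
(the common kernel is the `ℓ`-primitive part); the one remaining door — sporadic finite-level kernels — is a
bundle-existence problem on generic thickenings and, for fixed `p`, reaches only levels `n ≲ log₂(p/2g)`,
never `LiftsFormally`. So a composition concluding the crux would need a stub "P1b♮ off the
transport-reachable locus" (costume) or "separating sporadic kernels exist at every level" (false for
fixed `p`). Hence `no-skeleton`, and this file registers NO stubs on the crux item.

What the file DOES contain (all `sorry`-free; prose only in docstrings):

* §1 the ABSTRACT TRANSPORT CALCULUS behind the planner's sharpening of the card — the RECIPROCITY LAW
  (R) `0 = [Δ_Y(Φ_K E)]_{H^{0,2}(Y)} = [π_{2*}(td_X · (π_1^*Δ_X(E) · ch K + π_1^* ch E · Δ_{X×Y}(K)))]_{H^{0,2}}`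
  for the defect `Δ_r(X_{n+1} ⊃ X_n; E_n) := δ_{n+1}(ch_r^cris E₁) − ι ε_r σ_{r-1}(o(E_n))` — as
  bookkeeping theorems over abstract additive maps: `transport_componentZero_eq_zero` (covariance +
  known `T₀`-component on the auxiliary `Y` ⇒ the transported functional kills `Δ_X`),
  `reciprocity_componentZero` (the version with the kernel's own defect), and the finite upward
  induction `eq_zero_of_triangular_transport` (THEOREM B of the line card: a family of transports that is
  upper-triangular in the form degree `q` and separating on the diagonal forces `Δ = 0`);
* §2 REAL-CARRIER output predicates of the sharpened line, closed modulo the realization `C`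
  (named-fact pattern of `CrystallineRealization.BerthelotOgusLineBundleLifting`), using the tree's
  REAL semiregularity components `σ₀`, `σ₁` (`HodgeTheory.IsZeroOneSemiregular`, landed 2026-08-16) —
  no `σ`-as-data package, so no re-decoration: `ZeroOneStepLiftingAt`, `AbelianThreefoldStepLifting`
  (the card's `d = 3` output, `p ≥ 7`), `SuperspecialFirstStepLifting` (NEW: first step of the tower on
  superspecial product fibres `E^{g+1}`, every `g`, from level-1 line-bundle kernels — Theorem A / Cor A3
  of the line card);
* §3 the real glue `liftsAlong_of_sigma_vanishing`: over the tree's `VectorBundleExtensionObstruction`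
  and the bridge `SemiregularityObstructionBridge`, "`σ₀(o(F)) = 0 ∧ σ₁(o(F)) = 0` for a lift `F` of a
  `{0,1}`-semiregular `E₁`" ⇒ `LiftsAlong` — the exact shape in which any identity line (this one, or
  `absolute-atiyah-window-collapse` / `cartan-classifying-map`) feeds the route.

Disproof.lean used (Cruxes/…/Disproof.lean, cycles 1–2): §1 Finding 1 (additivity (A) ⇒ `Δ` factors
through `K₀`, used in (K2) of the card); §6 torsor test (landed `Theorems/…/Negative/TorsorTest`:
lift-dependence of `σ(o)` is a Bockstein image — consistent with `Δ` intrinsic under `H_tf`); §7 (landed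
`Theorems/…/Negative/DividedPowerWindowCollapse`, and `liftsStep_of_padicBlochIdentity`: the USE-skeleton
`identity + Hodge + H_tf + Deligne–Illusie ⇒ o = 0`, of which `liftsAlong_of_sigma_vanishing` is the
real-carrier tail) — the two landed Negative modules are honoured but NOT imported: nothing here is an
instance they refute, and the farm snapshot at check time (stale:154) had not built their oleans;
§3 `not_lifts_without_classHypothesis` / `star_false_without_injectivity` (every predicate below keeps
the Hodge condition AND semiregularity). No `_false_without_` theorem is contradicted: `H_tf` is
automatic on abelian schemes and is where `Δ` is normalised.
-/

noncomputable section

open CategoryTheory AlgebraicGeometry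

universe u

set_option linter.dupNamespace false

namespace Summit.HodgeConjecture.HodgeConjecture.Cruxes.PadicPridhamSemiregularity.FourierRotation

/-! ## §1  Abstract transport calculus (the bookkeeping of the reciprocity law) -/

section Transport

/-- **Transport of the defect to an auxiliary variety.** Abstractly: `ΔX : KX → HX` is the defect
`E ↦ Δ_X(E)` on (a `K₀`-type group of) objects of `X_n`, `ΔY` the same on `Y_n`, `Φ` the integral
transform `E ↦ Φ_K(E) = Rπ_{2*}(π_1^* E ⊗ K)` for a kernel `K` on `X_n × Y_n`, `Ψ` its cohomological
shadow `x ↦ π_{2*}(td_X · π_1^* x · ch K)`, `Ξ E = π_{2*}(td_X · π_1^* ch E · Δ(K))` the kernel term, and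
`π₀` the projection to the form-degree-`0` component `T₀(Y) = H²(Y₁, 𝒪) ⊗ I`. HYPOTHESES = the line's
stubs: `hcov` = full covariance (pull-back functoriality + `⊗`-derivation + `o(Rπ_*F) = (Rπ_*)_♯ o(F)` +
relative Lefschetz–Riemann–Roch for the Atiyah–Chern character of an endomorphism + crystalline GRR),
`hK` = `Δ(K) = 0` (K a LINE BUNDLE at level `n` — Leibniz + Berthelot–Ogus, no liftability — or `K`
restricted from level `n+1`), `hK1` = the known `T₀`-component on `Y` (rank one: `tr o = o(det)` +
level-wise Berthelot–Ogus). CONCLUSION: the transported functional `π₀ ∘ Ψ` kills every `Δ_X(E)`.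
[folklore] -/
theorem transport_componentZero_eq_zero {KX KY HX HY T : Type*} [AddCommGroup KX]
    [AddCommGroup KY] [AddCommGroup HX] [AddCommGroup HY] [AddCommGroup T]
    (ΔX : KX →+ HX) (ΔY : KY →+ HY) (Φ : KX →+ KY) (Ψ : HX →+ HY) (Ξ : KX →+ HY) (π₀ : HY →+ T)
    (hcov : ∀ E, ΔY (Φ E) = Ψ (ΔX E) + Ξ E) (hK : Ξ = 0) (hK1 : π₀.comp ΔY = 0) :
    π₀.comp (Ψ.comp ΔX) = 0 := by
  ext E
  have h1 : π₀ (ΔY (Φ E)) = 0 := by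
    have := DFunLike.congr_fun hK1 (Φ E)
    rwa [AddMonoidHom.comp_apply, AddMonoidHom.zero_apply] at this
  rw [hcov E, hK, AddMonoidHom.zero_apply, add_zero] at h1
  rw [AddMonoidHom.comp_apply, AddMonoidHom.comp_apply, AddMonoidHom.zero_apply]
  exact h1

/-- **The reciprocity law (R) in its bilinear form**: without assuming `Δ(K) = 0`, the known
`T₀`-component on `Y` expresses the transported defect of `E` through the defect of the kernel:
`π₀(Ψ(Δ_X E)) = −π₀(Ξ E)` — a bilinear reciprocity between the obstruction defects of `E` and of `K`
(with `E` a line bundle it constrains `Δ(K)` for EVERY perfect kernel `K`, e.g. Fourier–Mukai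
kernels that do not lift — cf. Lieblich–Olsson's p-adic deformation of kernels of K3 surfaces).
[folklore] -/
theorem reciprocity_componentZero {KX KY HX HY T : Type*} [AddCommGroup KX] [AddCommGroup KY]
    [AddCommGroup HX] [AddCommGroup HY] [AddCommGroup T]
    (ΔX : KX →+ HX) (ΔY : KY →+ HY) (Φ : KX →+ KY) (Ψ : HX →+ HY) (Ξ : KX →+ HY) (π₀ : HY →+ T)
    (hcov : ∀ E, ΔY (Φ E) = Ψ (ΔX E) + Ξ E) (hK1 : ∀ G, π₀ (ΔY G) = 0) (E : KX) :
    π₀ (Ψ (ΔX E)) = -π₀ (Ξ E) := by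
  have h := hK1 (Φ E)
  rw [hcov E, map_add] at h
  exact eq_neg_of_add_eq_zero_left h

/-- **THEOREM B of the line card (transport principle), abstract core.** The defect
`Δ = (Δ_q)_{q = 0..m}` lives in `⊕_q T_q` (`T_q = H^{q+2}(X₁, Ω^q) ⊗ I`, `m = d − 2`). Suppose:
(`h0`) the form-degree-`0` component vanishes (rank one / Berthelot–Ogus: (K1));
(`hvan`) for each `q` a transported functional `Ψ_q` (to `T₀` of an auxiliary `Y_q` through a kernel
with `Δ = 0`) kills `Δ` (`transport_componentZero_eq_zero`);
(`hupper`) `Ψ_q` sees nothing of the components of form degree `> q` (the kernel's `ch K` is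
concentrated in codimension `≥ d − q`: a correspondence of pure codimension `d − q` plus higher terms);
(`hsep`) `Ψ_q` is injective on the component `T_q` itself (the cylinder / Abel–Jacobi map
`[Γ_q]_* : H^{q,q+2}(X₁) → H^{0,2}(Y_{q,1})` is injective).
Then `Δ = 0`, by upward induction on `q`. WHERE IT APPLIES: abelian threefolds (Poincaré kernel), `q =
g − 2` on every abelian scheme, first step on Picard-saturated fibres, all levels on Picard-saturated
lifts, cubic fourfolds (Fano variety of lines, Beauville–Donagi); WHERE `hsep` FAILS for every kernel
algebraic on the generic fibre or of rank one: generic anchors at levels `≥ 2` (transport no-go, line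
card §4; sporadic finite-level kernels: open, level-bounded in `p`). [folklore] -/
theorem eq_zero_of_triangular_transport {m : ℕ} {T : Fin (m + 1) → Type*}
    [∀ q, AddCommGroup (T q)] {R : Fin (m + 1) → Type*} [∀ q, AddCommGroup (R q)]
    (Ψ : ∀ q : Fin (m + 1), (∀ i, T i) →+ R q) (Δ : ∀ i, T i)
    (h0 : Δ 0 = 0)
    (hvan : ∀ q, Ψ q Δ = 0)
    (hupper : ∀ (q i : Fin (m + 1)), q < i → ∀ v : T i, Ψ q (Pi.single i v) = 0)
    (hsep : ∀ q : Fin (m + 1), q ≠ 0 → ∀ v : T q, Ψ q (Pi.single q v) = 0 → v = 0) :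
    Δ = 0 := by
  classical
  have key : ∀ n : ℕ, ∀ i : Fin (m + 1), (i : ℕ) ≤ n → Δ i = 0 := by
    intro n
    induction n with
    | zero =>
      intro i hi
      have : i = 0 := Fin.ext (by simpa using hi)
      subst this
      exact h0
    | succ n ih =>
      intro i hi
      rcases Nat.lt_or_ge (i : ℕ) (n + 1) with hlt | hge
      · exact ih i (by omega)
      · have hi0 : i ≠ 0 := by
          intro h
          subst h
          simp at hge
        apply hsep i hi0
        have hsum : Ψ i Δ = ∑ j, Ψ i (Pi.single j (Δ j)) := by
          conv_lhs => rw [← Finset.univ_sum_single Δ]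
          rw [map_sum]
        rw [hvan i, Finset.sum_eq_single i] at hsum
        · exact hsum.symm
        · intro j _ hji
          rcases lt_or_gt_of_ne hji with hlt' | hgt'
          · have hj : Δ j = 0 := ih j (by
              have := Fin.lt_def.mp hlt'
              omega)
            rw [hj, Pi.single_zero, map_zero]
          · exact hupper i j hgt' (Δ j)
        · intro h
          exact absurd (Finset.mem_univ i) h
  funext i
  exact key i i le_rfl

/-- The two-component case `m = 1` (a THREEFOLD: only `T₀ = H²(𝒪)` and `T₁ = H³(Ω¹)`), which is the
card's rotation: one transport (`Φ_P` to the dual abelian threefold, `T₁(X) ≅ T₀(X̂)`) suffices.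
[folklore] -/
theorem eq_zero_of_rotation {T₀ T₁ R : Type*} [AddCommGroup T₀] [AddCommGroup T₁] [AddCommGroup R]
    (Ψ : T₀ × T₁ →+ R) (Δ : T₀ × T₁) (h0 : Δ.1 = 0) (hvan : Ψ Δ = 0)
    (hsep : ∀ v : T₁, Ψ (0, v) = 0 → v = 0) : Δ = 0 := by
  obtain ⟨a, b⟩ := Δ
  simp only at h0
  subst h0
  exact Prod.ext rfl (hsep b hvan)

end Transport

/-! ## §2  Real-carrier output predicates of the sharpened line -/

section Witt

open Literature.AlgebraicGeometry.Motives Literature.AlgebraicGeometry.Motives.WittScheme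
  Literature.AlgebraicGeometry.Crystalline Literature.AlgebraicGeometry.Deformation
  Literature.AlgebraicGeometry.HodgeTheory Literature.AlgebraicGeometry.Modules

variable {p : ℕ} [Fact p.Prime] {k : Type u} [Field k] [CharP k p] [PerfectRing k p]

/-- TORSION-FREE HODGE COHOMOLOGY of a `W`-model `𝒳` in all bidegrees (`Hᵇ(𝒳, Ωᵃ_{𝒳/W})` has no
`p`-torsion): the crux's standing hypothesis `H_tf`, automatic for abelian schemes; it is where the
defect `Δ` is normalised (Disproof §6–§7: `not_liftsStep_without_pnInjective`). [folklore] -/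
def HodgeTorsionFree (𝒳 : SchemeOver (WittVector p k)) : Prop :=
  ∀ (a b : ℕ) (x : hodgeCohomology 𝒳 a b), (p : ℤ) • x = 0 → x = 0

/-- `𝒳/W` is an ABELIAN MODEL of relative dimension `g`: a smooth projective model whose special fibre
underlies an abelian variety (then `𝒳` is an abelian scheme — `W`-section by Hensel, Mumford GIT
Prop. 6.15 — with dual `𝒳̂` and Poincaré bundles `𝒫_n` on every `X_n × X̂_n`). [folklore] -/
def IsAbelianModel (g : ℕ) (𝒳 : SchemeOver (WittVector p k)) : Prop :=
  IsSmoothProperModel g 𝒳 ∧ IsProjectiveOverRing 𝒳 ∧ ∃ A : AbelianVariety k, A.X = specialFibre 𝒳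

/-- The special fibre of `𝒳` is a SUPERSPECIAL PRODUCT `E^{g+1}` (`E` a supersingular elliptic curve
over `k`): the certified instance of PICARD SATURATION `span_k c₁(NS(X₁)) = H¹(X₁, Ω¹)` (graphs of
`α ∈ End(E) ↠ 𝔽_{p²}` contribute the vectors `(x, x^p)` in the two mixed Künneth summands). The route's
`E^{2n}`-anchors are of this shape up to isogeny. [folklore] -/
def HasSuperspecialProductFibre (g : ℕ) (𝒳 : SchemeOver (WittVector p k)) : Prop :=
  ∃ A E : AbelianVariety k, A.X = specialFibre 𝒳 ∧ E.IsSupersingularEllipticCurve ∧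
    Nonempty (A ≅ E.powSucc g)

/-- **STEP LIFTING AT LEVEL `n` for `{0,1}`-semiregular bundles** (real carriers throughout): every
finite locally free `F` on `X_{n+1}` whose restriction to the special fibre is a `{0,1}`-SEMIREGULAR
`E₁` (`σ₀ ⊕ σ₁ = (Tr, Tr(At ∘ −))` injective on `Ext²(E₁,E₁)`, `HodgeTheory.IsZeroOneSemiregular` — on a
threefold this IS p-adic semiregularity, `H^{q+2}(Ω^q) = 0` for `q ≥ 2`; in higher dimension it is a
STRONGER hypothesis, so every statement below remains a consequence of the full identity `Δ = 0`)
satisfying the Bloch–Esnault–Kerz Hodge condition lifts along `X_{n+1} ⟶ X_{n+2}`. [folklore] -/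
def ZeroOneStepLiftingAt (C : CrystallineRealization p k) (𝒳 : SchemeOver (WittVector p k))
    (n : ℕ) : Prop :=
  ∀ (E₁ : (specialFibre 𝒳).left.Modules) (hE₁ : IsFiniteLocallyFree E₁),
    IsZeroOneSemiregular.{u + 1} hE₁ → C.HodgeCondition 𝒳 E₁ →
    ∀ (F : (thickening 𝒳 (n + 1)).left.Modules), IsFiniteLocallyFree F →
      Nonempty ((Scheme.Modules.pullback (specialFibreToThickening 𝒳 n)).obj F ≅ E₁) →
      LiftsAlong (thickeningMap 𝒳 (Nat.le_succ (n + 1))) F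

/-- Step lifting at every level. With `TowerAssembly` (IdeatorTwoSketch) it gives `LiftsFormally`
without the typed crux P1a and without `K₀`. [folklore] -/
def ZeroOneStepLifting (C : CrystallineRealization p k) (𝒳 : SchemeOver (WittVector p k)) : Prop :=
  ∀ n : ℕ, ZeroOneStepLiftingAt C 𝒳 n

/-- **TARGET A1 — the card's output (`d = 3`), now closed over real carriers modulo `C`.** For the
classical crystalline realization: on every abelian THREEFOLD model over `W(k)`, `p ≥ 7` (`(2g)! = 6!`
must be a unit for the Mukai/Chern-character components of the Poincaré kernel, triage r1-3 (d)),
`{0,1}`-semiregular bundles with the Hodge condition lift step by step at every level. Mechanism: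
`Δ_{T₀} = 0` (rank one) and `Δ_{T₁}(E) ↦ [Φ_P^H Δ(E)]_{T₀(X̂)} = 0` (reciprocity with the LIFTABLE
Poincaré kernel; `Φ_P^H : H^{1,3}(X₁) ≅ H^{0,2}(X̂₁)`), `eq_zero_of_rotation`. A property of `C`
(named-fact pattern), consumed as a hypothesis; expected TRUE for the classical `C` given the line's
stubs (line card §2). [folklore] -/
def AbelianThreefoldStepLifting (C : CrystallineRealization p k) : Prop :=
  7 ≤ p → ∀ ⦃𝒳 : SchemeOver (WittVector p k)⦄, IsAbelianModel 3 𝒳 → ZeroOneStepLifting C 𝒳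

/-- **TARGET A3 — NEW with the planner's sharpening: the FIRST STEP of the tower on superspecial
product fibres, every dimension.** For the classical `C`: if `𝒳/W` is an abelian model of relative
dimension `g + 1` with `2(g+1) < p` whose special fibre is `E^{g+1}`, `E` supersingular, then every
finite locally free `{0,1}`-semiregular `E₁` on `X₁` with the Hodge condition lifts to `X₂` (level
`n = 0` of `ZeroOneStepLiftingAt`; the thickening `X₂` is arbitrary — the generic lifts of the route's
anchors included). Mechanism (Theorem A of the line card at `n = 1`): reciprocity with the LEVEL-1 line
bundle kernels `𝒫 ⊗ π₁^* L_a`, `a ∈ NS(X₁)` — which need NOT lift — gives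
`Δ_q(E₁) ∪ a₁ ∪ ⋯ ∪ a_{g−1−q} = 0`, and Picard saturation of `E^{g+1}` plus
`H^{a,b}(X₁) = ΛᵃH⁰(Ω¹) ⊗ ΛᵇH¹(𝒪)` force `Δ_q(E₁) = 0` for all `q`. Levels `n ≥ 2` are NOT claimed
(transport no-go). [folklore] -/
def SuperspecialFirstStepLifting (C : CrystallineRealization p k) : Prop :=
  ∀ ⦃g : ℕ⦄ ⦃𝒳 : SchemeOver (WittVector p k)⦄, IsAbelianModel (g + 1) 𝒳 → 2 * (g + 1) < p →
    HasSuperspecialProductFibre g 𝒳 → ZeroOneStepLiftingAt C 𝒳 0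

/-- On an abelian threefold model both targets speak about level `0`; A1 is the stronger there (all
levels), A3 the wider (all `g`). Consistency of the two typed predicates (pure logic). [folklore] -/
theorem zeroOneStepLiftingAt_zero_of_stepLifting (C : CrystallineRealization p k)
    {𝒳 : SchemeOver (WittVector p k)} (h : ZeroOneStepLifting C 𝒳) : ZeroOneStepLiftingAt C 𝒳 0 :=
  h 0

/-! ## §3  Real glue: vanishing of `σ₀, σ₁` on the obstruction of a lift ⇒ the lift extends -/

omit [PerfectRing k p] in
/-- **The real-carrier tail of the USE-skeleton** (`Disproof.liftsStep_of_padicBlochIdentity` ends in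
"`o = 0`"; this turns "`σ₀(o(F)) = 0 ∧ σ₁(o(F)) = 0`" into `LiftsAlong` over the tree's REAL obstruction
groups). Data: an obstruction theory `V` (the tree's hypothesis structure over real carriers), a
first-order thickening `i : X_{n+1} ⟶ X_{n+2}` of the tower whose ideal `pⁿ⁺¹𝒪/pⁿ⁺²𝒪` is identified
(`e`) with `j_*𝒪_{X₁}` along the closed immersion `j : X₁ ⟶ X_{n+1}` (both structure facts of the Witt
tower are carried as instance hypotheses: the tree has no instances for them yet), a finite locally free
`F` on `X_{n+1}` with
`j^*F ≅ E₁`. If `E₁` is `{0,1}`-semiregular and both real semiregularity components kill the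
obstruction class of `F` read on `X₁` (`V.obOnBase`, Lieblich Cor. 3.1.2) — which is what ANY proof of
the identity `Δ(F) = 0` delivers under the Hodge condition and `H_tf` — then `F` lifts across `i`.
Sorry-free; every hypothesis is a real proposition. [folklore] -/
theorem liftsAlong_of_sigma_vanishing (V : VectorBundleExtensionObstruction.{u})
    {𝒳 : SchemeOver (WittVector p k)} (n : ℕ) [IsClosedImmersion (specialFibreToThickening 𝒳 n)]
    [IsFirstOrderThickening (thickeningMap 𝒳 (Nat.le_succ (n + 1)))]
    (F : (thickening 𝒳 (n + 1)).left.Modules) (hF : IsFiniteLocallyFree F)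
    (E₁ : (specialFibre 𝒳).left.Modules) (hE₁ : IsFiniteLocallyFree E₁)
    (α : (Scheme.Modules.pullback (specialFibreToThickening 𝒳 n)).obj F ≅ E₁)
    (e : conormalSheaf (thickeningMap 𝒳 (Nat.le_succ (n + 1))) ≅
      (Scheme.Modules.pushforward (specialFibreToThickening 𝒳 n)).obj
        (unitModule (specialFibre 𝒳).left))
    (hsr : IsZeroOneSemiregular.{u + 1} hE₁)
    (h0 : sigmaZeroObstruction hE₁
      (V.obOnBase (specialFibreToThickening 𝒳 n) (thickeningMap 𝒳 (Nat.le_succ (n + 1))) F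
        hF.isVectorBundle α (unitModule (specialFibre 𝒳).left) e) = 0)
    (h1 : sigmaOneObstruction hE₁
      (V.obOnBase (specialFibreToThickening 𝒳 n) (thickeningMap 𝒳 (Nat.le_succ (n + 1))) F
        hF.isVectorBundle α (unitModule (specialFibre 𝒳).left) e) = 0) :
    LiftsAlong (thickeningMap 𝒳 (Nat.le_succ (n + 1))) F :=
  (V.obOnBase_eq_zero_iff (specialFibreToThickening 𝒳 n) (thickeningMap 𝒳 (Nat.le_succ (n + 1))) F
      hF.isVectorBundle α (unitModule (specialFibre 𝒳).left) e).mp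
    ((isZeroOneSemiregular_iff_obstruction hE₁).mp hsr _ h0 h1)

/-- **How an identity line closes `ZeroOneStepLiftingAt`** (pure logic over real carriers): it must
supply, for the tower's step, the first-order-thickening structure, the identification of the ideal
with `𝒪_{X₁}`, and the vanishing of `σ₀, σ₁` on the obstruction of every lift `F` of a Hodge,
`{0,1}`-semiregular `E₁`. This is the checkable CONTRACT between this oracle and the lead's line.
[folklore] -/
theorem zeroOneStepLiftingAt_of_identity (V : VectorBundleExtensionObstruction.{u})
    (C : CrystallineRealization p k) {𝒳 : SchemeOver (WittVector p k)} (n : ℕ)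
    [IsClosedImmersion (specialFibreToThickening 𝒳 n)]
    [IsFirstOrderThickening (thickeningMap 𝒳 (Nat.le_succ (n + 1)))]
    (e : conormalSheaf (thickeningMap 𝒳 (Nat.le_succ (n + 1))) ≅
      (Scheme.Modules.pushforward (specialFibreToThickening 𝒳 n)).obj
        (unitModule (specialFibre 𝒳).left))
    (identity : ∀ (E₁ : (specialFibre 𝒳).left.Modules) (hE₁ : IsFiniteLocallyFree E₁),
      C.HodgeCondition 𝒳 E₁ →
      ∀ (F : (thickening 𝒳 (n + 1)).left.Modules) (hF : IsFiniteLocallyFree F)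
        (α : (Scheme.Modules.pullback (specialFibreToThickening 𝒳 n)).obj F ≅ E₁),
        sigmaZeroObstruction hE₁ (V.obOnBase (specialFibreToThickening 𝒳 n)
            (thickeningMap 𝒳 (Nat.le_succ (n + 1))) F hF.isVectorBundle α
            (unitModule (specialFibre 𝒳).left) e) = 0 ∧
          sigmaOneObstruction hE₁ (V.obOnBase (specialFibreToThickening 𝒳 n)
            (thickeningMap 𝒳 (Nat.le_succ (n + 1))) F hF.isVectorBundle α
            (unitModule (specialFibre 𝒳).left) e) = 0) :
    ZeroOneStepLiftingAt C 𝒳 n := by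
  intro E₁ hE₁ hsr hH F hF hα
  obtain ⟨α⟩ := hα
  obtain ⟨h0, h1⟩ := identity E₁ hE₁ hH F hF α
  exact liftsAlong_of_sigma_vanishing V n F hF E₁ hE₁ α e hsr h0 h1

end Witt

end Summit.HodgeConjecture.HodgeConjecture.Cruxes.PadicPridhamSemiregularity.FourierRotation

end
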